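import Summits.PneNP.PneNP.Theorems.SymmetryBudgetWindowCanoniserSemMain1b

/-!
# Window canoniser, XX: gate semantics of the main computation — parts and their colour ranks

Route `PneNP/SymmetryBudget`, dichotomy `WindowBarrier` (stmt-PneNP-2145) / `NoHiddenOrder` (stmt-PneNP-14781);
continuation of `…WindowCanoniserSemMain1b.lean`.  The section families, first half: `isP u U'`
(`WCan.isPartP`: `U'` is the switched-graph part of `u` in the final state), `pcov u` (that part is
certified), `pnonbot` (every part is certified), `pbit u i` (`WCan.pbitP`: bit `i` of the part vector of the
part of `u` — its size in one-hot, or a value bit of the part child), `rkInGE`/`WCan.rkIn` (colour ranks inside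
a part), `pcP U' p w` (position `p` of the part's value has the colour of `w`), `ppc`, `pcrk` (that colour's rank
in my final colouring).
-/

-- `Summit.PneNP.PneNP.…` duplicates `PneNP` BY DESIGN (single-problem summit, D-0017 layout).
set_option linter.dupNamespace false

noncomputable section

namespace Summit.PneNP.PneNP.Theorems

namespace WCan

open Finset Literature.Computability.Complexity Literature.Computability.Complexity.CGCanon
  Literature.Combinatorics.SimpleGraph
open scoped Classical

variable {K r n : ℕ}

section MathSide

variable [NeZero n] (L : Lab K n) (x : Fin (r + n) × Fin (r + n) → Bool)

/-- `U'` IS THE PART OF `u`: `u ∈ U`, `∅ ≠ U' ⊂ U`, and `U'` is the set of vertices reachable from `u` in the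
switched graph of the final state (with `u` in its vertex set). -/
def isPartP (u : Fin n) (U' : Finset (Fin n)) : Prop :=
  u ∈ L.1.U ∧ U' ⊂ L.1.U ∧ U'.Nonempty ∧
    ∀ v, v ∈ U' ↔ (u ∈ (finSt L.1 x).W ∧ (swG (G x) (finSt L.1 x).W (finSt L.1 x).c).Reachable u v)

/-- The part child `U'` is CERTIFIED (read at ambient vertex `z`). -/
def certS (U' : Finset (Fin n)) (z : Fin n) : Prop := ev x (aCert (r := r) L (Sum.inr U') z) = true

/-- Bit `i` of the PART VECTOR of the part of `u`: the size of the part in one-hot, or a value bit of the part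
child's group. -/
def pbitP (u : Fin n) (i : Fin (NBp r n)) : Prop :=
  ∃ U', isPartP (r := r) L x u U' ∧
    match bpdec i with
    | Sum.inl s => U'.card = (s : ℕ)
    | Sum.inr b => ∃ Lc, partLab L U' = some Lc ∧ ev x (aVbit (r := r) Lc u b) = true

/-- The RANK of `w` INSIDE `U'`: members of `U'` of smaller lifted colour in the final state. -/
def rkIn (U' : Finset (Fin n)) (w : Fin n) : ℕ := (U'.filter fun w' => (finSt L.1 x).liftLT w' w).card

/-- EQUAL lifted COLOURS in the final state. -/
def EQP (a b : Fin n) : Prop := ¬ (finSt L.1 x).liftLT a b ∧ ¬ (finSt L.1 x).liftLT b a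

/-- `pcP U' p w`: position `p` of the value of the part child `U'` carries the colour of `w`
(witnessed by a member `w''` of `U'` of that colour whose rank inside `U'` is the recorded one). -/
def pcPP (U' : Finset (Fin n)) (p w : Fin n) : Prop :=
  ∃ Lc, partLab L U' = some Lc ∧ ∃ w'' ∈ U', ∃ j : Fin n,
    ev x (aVbit (r := r) Lc w (benc (.crk p j))) = true ∧ rkIn (r := r) L x U' w'' = j ∧ EQP (r := r) L x w'' w

end MathSide

variable [NeZero n] {L : Lab K n} {x : Fin (r + n) × Fin (r + n) → Bool} (hn : 2 ≤ n)
include hn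

/-! ### Parts -/

/-- `isP u U'`. -/
theorem ev_aIsP (u : Fin n) (U' : Finset (Fin n)) : ev x (aIsP L u U') = decide (isPartP (r := r) L x u U') := by
  have hT := corr_fin (L := L) (x := x) hn
  apply Bool.eq_iff_iff.2
  show Vl K x _ = true ↔ _
  rw [Vl_eq, decide_eq_true_iff]
  show (GateFn.and n).2 (fun i => GateDAG.wire x (Vl K x) (Kind.argsM L .isP (prm (vec1 u) (us := U')) i)) = true ↔ _
  simp only [GateFn.and, decide_eq_true_iff, Kind.argsM, prm_vs, prm_us, vec1_apply]
  by_cases hc : u ∈ L.1.U ∧ U' ⊂ L.1.U ∧ U'.Nonempty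
  · simp only [hc, and_self, ↓reduceIte, isPartP, true_and]
    refine forall_congr' fun v => ?_
    have hr : ev x (aReach L (tf n) (Fin.last n) u v) = true ↔
        (u ∈ (finSt L.1 x).W ∧ (swG (G x) (finSt L.1 x).W (finSt L.1 x).c).Reachable u v) := by
      rw [ev_aReach (r := r) hT, decide_eq_true_iff, Fin.val_last, reachK_last_iff]
    split_ifs with hv
    · rw [wire_wA, hr]; simp [hv]
    · rw [wire_wN, Bool.not_eq_true', ← Bool.not_eq_true, hr]; simp [hv]
  · simp only [hc, ↓reduceIte, wire_wA, ev_ff, isPartP]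
    constructor
    · intro h; exact absurd (h ⟨0, by have := NeZero.one_le (n := n); omega⟩) Bool.false_ne_true
    · rintro ⟨h1, h2, h3, -⟩; exact absurd ⟨h1, h2, h3⟩ hc

/-- `pcov u`: the part of `u` is certified. -/
theorem ev_aPcov (u : Fin n) : ev x (aPcov L u) = decide (∃ U', isPartP (r := r) L x u U' ∧ certS (r := r) L x U' u) := by
  apply Bool.eq_iff_iff.2
  show Vl K x _ = true ↔ _
  rw [Vl_eq, decide_eq_true_iff]
  show (GateFn.or (2 ^ n)).2 (fun i => GateDAG.wire x (Vl K x) (Kind.argsM L .pcov (prm (vec1 u)) i)) = true ↔ _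
  simp only [GateFn.or, decide_eq_true_iff, Kind.argsM, prm_vs, vec1_apply, wire_w1]
  have key : ∀ U', Vl K x (.f1 (n1and [pos (aIsP L u U'), pos (aCert L (Sum.inr U') u)])) = true ↔
      isPartP (r := r) L x u U' ∧ certS (r := r) L x U' u := by
    intro U'; rw [Vl_n1and x _ (by simp)]; simp [ev_aIsP hn, certS]
  simp only [key]
  exact ⟨fun ⟨i, h⟩ => ⟨_, h⟩, fun ⟨U', h⟩ => ⟨(fsEnum n).symm U', by simpa using h⟩⟩

omit hn in
/-- `pnonbot`: every part is certified. -/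
theorem ev_aPnonbot (z : Fin n) : ev x (aPnonbot L z) = decide (∀ u ∈ L.1.U, ev x (aPcov (r := r) L u) = true) := by
  apply Bool.eq_iff_iff.2
  show Vl K x _ = true ↔ _
  rw [Vl_eq, decide_eq_true_iff]
  show (GateFn.and n).2 (fun i => GateDAG.wire x (Vl K x) (Kind.argsM L .pnonbot (prm (vec1 z)) i)) = true ↔ _
  simp only [GateFn.and, decide_eq_true_iff, Kind.argsM]
  refine forall_congr' fun u => ?_
  split_ifs with hu <;> simp [hu]

omit [NeZero n] hn in
/-- Decoding the size index. -/
@[simp] theorem bpdec_bpSize (s : Fin (n + 1)) : bpdec (bpSize (r := r) s) = Sum.inl s := by simp [bpdec, bpSize]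

omit [NeZero n] hn in
/-- Decoding a value index. -/
@[simp] theorem bpdec_bpVal (b : Fin (NB r n)) : bpdec (bpVal b) = Sum.inr b := by simp [bpdec, bpVal]

/-- `pbit u i`. -/
theorem ev_aPbit (u : Fin n) (i : Fin (NBp r n)) : ev x (aPbit L u i) = decide (pbitP (r := r) L x u i) := by
  apply Bool.eq_iff_iff.2
  show Vl K x _ = true ↔ _
  rw [Vl_eq, decide_eq_true_iff]
  show (GateFn.or (2 ^ n)).2 (fun e => GateDAG.wire x (Vl K x) (Kind.argsM L .pbit (prm (vec1 u) (bp := i.castSucc)) e)) = true ↔ _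
  simp only [GateFn.or, decide_eq_true_iff, Kind.argsM, prm_vs, vec1_apply, prm_bp, Fin.val_castSucc, Fin.is_lt, ↓reduceDIte,
    Fin.eta, pbitP]
  rw [(fsEnum n).exists_congr_left]
  simp only [Equiv.apply_symm_apply]
  refine exists_congr fun U' => ?_
  rcases hi : bpdec i with s | b
  · dsimp only
    rw [wire_w1, Vl_n1and x _ (by simp)]
    by_cases hs : U'.card = (s : ℕ) <;> simp [hs, ev_aIsP hn]
  · rcases hL : partLab L U' with _ | Lc
    · dsimp only
      simp
    · dsimp only
      rw [wire_w1, Vl_n1and x _ (by simp)]; simp [ev_aIsP hn]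

/-! ### Colour ranks inside a part -/

/-- `rkInGE U' w j` computes `j ≤ rkIn U' w`. -/
theorem ev_aRkInGE (U' : Finset (Fin n)) (w : Fin n) (j : Fin (n + 1)) :
    ev x (aRkInGE L U' w j) = decide ((j : ℕ) ≤ rkIn (r := r) L x U' w) := by
  have h := corr_fin (L := L) (x := x) hn
  apply Bool.eq_iff_iff.2
  show Vl K x _ = true ↔ _
  rw [Vl_eq, decide_eq_true_iff]
  show (GateFn.maj (n + n)).2 (fun i => GateDAG.wire x (Vl K x)
    (Kind.argsM L .rkInGE (prm (vec1 w) (s := j) (us := U')) i)) = true ↔ _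
  simp only [Kind.argsM, prm_s, prm_us, prm_vs, vec1_apply]
  rw [maj_cnt_iff x (Nat.lt_succ_iff.1 j.2)]
  have hw : ∀ w', GateDAG.wire x (Vl K x) (if w' ∈ U' then wA (aLT L (tf n) w' w) else wA (ffA (K := K) (r := r) (n := n))) = true ↔
      (w' ∈ U' ∧ (finSt L.1 x).liftLT w' w) := by
    intro w'; split_ifs with hw' <;> simp [hw', h.LT]
  simp only [hw, rkIn]
  rw [show (univ.filter fun w' => w' ∈ U' ∧ (finSt L.1 x).liftLT w' w) = U'.filter fun w' => (finSt L.1 x).liftLT w' w from by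
    ext; simp]

/-- The rank-inside formula holds iff `rkIn U' w = j`. -/
theorem Vl_rkInF (U' : Finset (Fin n)) (w j : Fin n) :
    Vl K x (.f1 (n1and [pos (aRkInGE L U' w j.castSucc), neg (aRkInGE L U' w j.succ)])) = true ↔ rkIn (r := r) L x U' w = j := by
  rw [Vl_n1and x _ (by simp)]
  simp only [List.mem_cons, List.not_mem_nil, or_false, forall_eq_or_imp, forall_eq, holds_pos, holds_neg, ev_aRkInGE hn,
    Fin.val_castSucc, Fin.val_succ, decide_eq_true_eq, decide_eq_false_iff_not]
  omega

/-- The equal-colour formula. -/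
theorem Vl_EQF (a b : Fin n) : Vl K x (.f1 (EQF L a b)) = true ↔ EQP (r := r) L x a b := by
  have h := corr_fin (L := L) (x := x) hn
  rw [EQF, Vl_n1and x _ (by simp)]
  simp [h.LT, EQP]

/-- `pcP U' p w`. -/
theorem ev_aPcP (U' : Finset (Fin n)) (p w : Fin n) : ev x (aPcP L U' p w) = decide (pcPP (r := r) L x U' p w) := by
  apply Bool.eq_iff_iff.2
  show Vl K x _ = true ↔ _
  rw [Vl_eq, decide_eq_true_iff]
  show (GateFn.or (n * n)).2 (fun i => GateDAG.wire x (Vl K x)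
    (Kind.argsM L .pcP (prm (vec1 w) (ns := nvec1 p) (us := U')) i)) = true ↔ _
  simp only [GateFn.or, decide_eq_true_iff, Kind.argsM, prm_us, prm_vs, prm_ns, vec1_apply, nvec1_apply, pcPP]
  rcases hL : partLab L U' with _ | Lc
  · simp
  · simp only [Option.some.injEq, exists_eq_left']
    have key : ∀ (w'' j : Fin n), GateDAG.wire x (Vl K x) (if w'' ∈ U' then
        w2 (n2and [litN1 (pos (aVbit Lc w (benc (.crk p j)))),
          n1and [pos (aRkInGE L U' w'' j.castSucc), neg (aRkInGE L U' w'' j.succ)], EQF L w'' w])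
        else wA ffA) = true ↔
        (w'' ∈ U' ∧ ev x (aVbit (r := r) Lc w (benc (.crk p j))) = true ∧ rkIn (r := r) L x U' w'' = j ∧ EQP (r := r) L x w'' w) := by
      intro w'' j
      split_ifs with hw
      · rw [wire_w2, Vl_n2and x _ (by simp)]
        simp only [List.mem_cons, List.not_mem_nil, or_false, forall_eq_or_imp, forall_eq, Vl_litN1, holds_pos,
          Vl_rkInF hn, Vl_EQF hn, hw, true_and]
      · simp [hw]
    constructor
    · rintro ⟨i, hi⟩
      rw [key] at hi
      exact ⟨_, hi.1, _, hi.2⟩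
    · rintro ⟨w'', hw'', j, hj⟩
      exact ⟨finProdFinEquiv (w'', j), by rw [Equiv.symm_apply_apply, key]; exact ⟨hw'', hj⟩⟩

/-- `ppc u p w`: position `p` of the part of `u` carries the colour of `w`. -/
theorem ev_aPpc (u p w : Fin n) : ev x (aPpc L u p w) =
    decide (∃ U', isPartP (r := r) L x u U' ∧ pcPP (r := r) L x U' p w) := by
  apply Bool.eq_iff_iff.2
  show Vl K x _ = true ↔ _
  rw [Vl_eq, decide_eq_true_iff]
  show (GateFn.or (2 ^ n)).2 (fun i => GateDAG.wire x (Vl K x) (Kind.argsM L .ppc (prm (vec2 u w) (ns := nvec1 p)) i)) = true ↔ _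
  simp only [GateFn.or, decide_eq_true_iff, Kind.argsM, prm_vs, prm_ns, vec2_0, vec2_1, nvec1_apply, wire_w1]
  have key : ∀ U', Vl K x (.f1 (n1and [pos (aIsP L u U'), pos (aPcP L U' p w)])) = true ↔
      isPartP (r := r) L x u U' ∧ pcPP (r := r) L x U' p w := by
    intro U'; rw [Vl_n1and x _ (by simp)]; simp [ev_aIsP hn, ev_aPcP hn]
  simp only [key]
  exact ⟨fun ⟨i, h⟩ => ⟨_, h⟩, fun ⟨U', h⟩ => ⟨(fsEnum n).symm U', by simpa using h⟩⟩

/-- `pcrk u p j`: the colour at position `p` of the part of `u` has rank `j` in my final colouring. -/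
theorem ev_aPcrk (u p j : Fin n) : ev x (aPcrk L u p j) =
    decide (∃ w, ev x (aPpc (r := r) L u p w) = true ∧ rankF L.1 x w = j) := by
  apply Bool.eq_iff_iff.2
  show Vl K x _ = true ↔ _
  rw [Vl_eq, decide_eq_true_iff]
  show (GateFn.or n).2 (fun i => GateDAG.wire x (Vl K x) (Kind.argsM L .pcrk (prm (vec1 u) (ns := nvec2 p j)) i)) = true ↔ _
  simp only [GateFn.or, decide_eq_true_iff, Kind.argsM, prm_vs, prm_ns, vec1_apply, nvec2_0, nvec2_1, wire_w2]
  refine exists_congr fun w => ?_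
  rw [Vl_n2and x _ (by simp)]
  simp [Vl_litN1, Vl_rkF hn]

end WCan

end Summit.PneNP.PneNP.Theorems

end
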